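import Literature.Probability.LatticeModels.MagnetizationExponentUpperDischarge
import HarnessLib

/-!
# Discharge of `spontaneousMagnetization_asymp_sqrt`: `m*(β) ≍ (β - β_c)^{1/2}` for `d > 4`

Topic `Probability/LatticeModels`, namespace `Literature.Probability.LatticeModels`. Proof file for
the named fact `Literature.Probability.LatticeModels.spontaneousMagnetization_asymp_sqrt` of
`Sweep1` (crit-ising.S13: for `d ≥ 5` there are `0 < c ≤ C` and `ε > 0` with
`c √(β - β_c) ≤ m*(β) ≤ C √(β - β_c)` on `(β_c, β_c + ε)`).

The upper half is Aizenman–Fernández's theorem `β̂ = 1/2` for `d > 4` (J. Stat. Phys. 44 (1986),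
§1 and §5: the random-current bound `δ ≥ 3` on the critical isotherm, Thm. 5.7 (b) with Thm. 5.6,
Lemma 5.5 and the backbone kernel of §4, followed by the extrapolation principles of
Aizenman–Barsky–Fernández 1987), now the tree theorem `spontaneousMagnetization_le_sqrt_holds`
(`MagnetizationExponentUpperDischarge`, assembling `BackboneKernel`, `ClusterDeficit`,
`AFBetaDerivativeKernelBoundTorus`, `MagnetizationExponentUpperAF57`, `MagnetizationExponentUpperAFeR`).
The lower half is the mean-field bound `m*(β) ≥ c (β - β_c)^{1/2}` (Aizenman–Barsky–Fernández 1987,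
Thm. 1), the tree theorem `meanField_lower_bound_holds`; the two are combined by
`spontaneousMagnetization_asymp_sqrt_of_le_sqrt` (`MagnetizationExponentUpper`).

Everything is proved; there are no named facts.

## References

* M. Aizenman, R. Fernández, *On the critical behavior of the magnetization in high-dimensional
  Ising models*, J. Stat. Phys. 44 (1986) 393–454, abstract and §1 (`β̂ = 1/2` for
  nearest-neighbour models in `d > 4`), §§4–5 [AizenmanFernandezJSP1986].
* M. Aizenman, D. J. Barsky, R. Fernández, *The phase transition in a general class of Ising-type
  models is sharp*, J. Stat. Phys. 47 (1987) 343–374, Thm. 1 (the lower bound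
  `m*(β) ≥ c (β - β_c)^{1/2}`) [AizenmanBarskyFernandezJSP1987].
-/

noncomputable section

namespace Literature.Probability.LatticeModels

/-- **Aizenman–Fernández 1986 with Aizenman–Barsky–Fernández 1987: `m*(β) ≍ (β - β_c)^{1/2}` near
`β_c⁺` for the nearest-neighbour Ising model in `d > 4`** — the named fact
`spontaneousMagnetization_asymp_sqrt`, from its upper half `spontaneousMagnetization_le_sqrt_holds`
(Aizenman–Fernández) and the tree's mean-field lower bound, via
`spontaneousMagnetization_asymp_sqrt_of_le_sqrt`. [cite: AizenmanFernandezJSP1986, abstract and §1 (β̂ = 1/2 for nearest-neighbour models, d > 4); §5.2, Thms. 5.6–5.7] [cite: AizenmanBarskyFernandezJSP1987, Thm. 1 (lower bound)] -/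
theorem spontaneousMagnetization_asymp_sqrt_holds : spontaneousMagnetization_asymp_sqrt :=
  spontaneousMagnetization_asymp_sqrt_of_le_sqrt spontaneousMagnetization_le_sqrt_holds

end Literature.Probability.LatticeModels
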